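import Summits.AtomisticToContinuum.Crystallization.Theorems.GscTwinLoopSurgeryGscHingeGlueLimit
import Literature.MathematicalPhysics.StatisticalMechanics.LennardJonesClusters

/-!
# Route `GscTwinLoopSurgery`, support item `GscHingeGlue` (stmt-AtomisticToContinuum-14087): the finite-`N` step

**Lemma B of the glue** (Step 2 of the item's sketch). Input: the infinite-volume core in the
form "every `r₀`-dense `X ∈ 𝔏` has, at every scale, a particle with a good hcp window"
(hypothesis `hcore`, = Lemma A) and the cohesion statement `NoFoam` at void size `r₀`
(hypothesis `hfoam`). Output (`eventually_density_good`): for every sequence of Lennard-Jones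
ground states and every scale `(R, ε)` there is `ρ > 0` such that for all large `N` at least
`ρ N` particles are good for SOME `hcpStacking a h`, `(a, h) ∈ B′`.

* `exists_good_near_deep` — by contradiction and compactness: if deep particles (no `r₀`-void
  within `R'`) without a good particle within `L` persisted for `L, R' → ∞`, the recentred
  configurations would converge to an `r₀`-dense `Y ∈ 𝔏` whose good particle (from `hcore`)
  pulls back to a good particle near the deep one;
* counting: `NoFoam` makes at least `N/2` particles deep, the deep-to-good assignment has fibres
  of size `≤ (2L/δ + 1)³` (packing, `card_le_of_separated_of_dist_le`, `δ` the minimal distance).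

All `[folklore]`; nothing here closes an item.
-/

noncomputable section

open scoped BigOperators Topology
open Filter Set Metric

namespace Summit.AtomisticToContinuum.Crystallization.Theorems.GscHingeGlue

open Literature.MathematicalPhysics.StatisticalMechanics

/-! ## Good particles near deep particles -/

/-- **Deep particles have good neighbours (uniformly, for large `N`).** [folklore] -/
theorem exists_good_near_deep {r₀ : ℝ}
    (hcore : ∀ X : Set (EuclideanSpace ℝ (Fin 3)), IsLocalLimitOfGroundStates lennardJones 3 X →
      (∀ c, ∃ q ∈ X, dist q c ≤ r₀) → ∀ R ε : ℝ, 0 ≤ R → 0 < ε → ε ≤ 1 →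
      ∃ p ∈ X, ∃ a h : ℝ, (191 / 200 ≤ a ∧ a ≤ 197 / 200 ∧ 81 / 100 * a ≤ h ∧ h ≤ 329 / 400 * a) ∧
        ∃ (A : EuclideanSpace ℝ (Fin 3) →ₗᵢ[ℝ] EuclideanSpace ℝ (Fin 3)) (q : EuclideanSpace ℝ (Fin 3)),
          q ∈ hcpStacking a h ∧ BallMatch ε R p X ((fun s => p + A (s - q)) '' hcpStacking a h))
    (x : (N : ℕ) → Fin N → EuclideanSpace ℝ (Fin 3))
    (hx : ∀ N, IsGroundState lennardJones (x N)) {R ε : ℝ} (hR : 0 ≤ R) (hε : 0 < ε) (hε1 : ε ≤ 1) :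
    ∃ (L R' : ℝ), 0 < R' ∧ ∃ N₀ : ℕ, ∀ N : ℕ, N₀ ≤ N → ∀ i : Fin N,
      (¬ ∃ c : EuclideanSpace ℝ (Fin 3), dist c (x N i) ≤ R' ∧ ∀ j : Fin N, r₀ ≤ dist c (x N j)) →
      ∃ j : Fin N, dist (x N j) (x N i) ≤ L ∧ ∃ a h : ℝ,
        (191 / 200 ≤ a ∧ a ≤ 197 / 200 ∧ 81 / 100 * a ≤ h ∧ h ≤ 329 / 400 * a) ∧
        ∃ A : EuclideanSpace ℝ (Fin 3) →ₗᵢ[ℝ] EuclideanSpace ℝ (Fin 3), ∃ q ∈ hcpStacking a h,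
          (∀ s ∈ hcpStacking a h, dist s q ≤ R → ∃ j', dist (x N j') (x N j + A (s - q)) ≤ ε) ∧
          (∀ j', dist (x N j') (x N j) ≤ R →
            ∃ s ∈ hcpStacking a h, dist (x N j') (x N j + A (s - q)) ≤ ε) := by
  classical
  -- the goodness predicate
  set Good : (N : ℕ) → Fin N → Prop := fun N j => ∃ a h : ℝ,
      (191 / 200 ≤ a ∧ a ≤ 197 / 200 ∧ 81 / 100 * a ≤ h ∧ h ≤ 329 / 400 * a) ∧
      ∃ A : EuclideanSpace ℝ (Fin 3) →ₗᵢ[ℝ] EuclideanSpace ℝ (Fin 3), ∃ q ∈ hcpStacking a h,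
        (∀ s ∈ hcpStacking a h, dist s q ≤ R → ∃ j', dist (x N j') (x N j + A (s - q)) ≤ ε) ∧
        (∀ j', dist (x N j') (x N j) ≤ R → ∃ s ∈ hcpStacking a h, dist (x N j') (x N j + A (s - q)) ≤ ε)
    with hGood
  -- suppose not: bad deep particles at every level `k`
  by_contra H
  have hbad : ∀ k : ℕ, ∃ᶠ N : ℕ in atTop, ∃ i : Fin N,
      (∀ c : EuclideanSpace ℝ (Fin 3), dist c (x N i) ≤ (k : ℝ) + 1 → ∃ j : Fin N, dist c (x N j) < r₀) ∧
      ∀ j : Fin N, dist (x N j) (x N i) ≤ (k : ℝ) + 1 → ¬ Good N j := by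
    intro k
    refine frequently_atTop.2 fun N₀ => ?_
    by_contra H'
    apply H
    refine ⟨(k : ℝ) + 1, (k : ℝ) + 1, by positivity, N₀, fun N hN i hdeep => ?_⟩
    by_contra H''
    apply H'
    refine ⟨N, hN, i, fun c hc => ?_, fun j hj hgood => H'' ⟨j, hj, hgood⟩⟩
    by_contra H3
    push Not at H3
    exact hdeep ⟨c, hc, H3⟩
  obtain ⟨φ, hφ, hP⟩ := extraction_forall_of_frequently hbad
  choose i hdeep hbad' using hP
  -- recentred configurations and their local limit
  obtain ⟨δ, hδ, hsep⟩ := LennardJonesMinimalDistance_holds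
  set Yk : ℕ → Set (EuclideanSpace ℝ (Fin 3)) :=
    fun k => Set.range fun j => x (φ k) j + -(x (φ k) (i k)) with hYk
  have hsepY : ∀ k, ∀ p ∈ Yk k, ∀ q ∈ Yk k, p ≠ q → δ ≤ dist p q := by
    rintro k _ ⟨j, rfl⟩ _ ⟨j', rfl⟩ hne
    rw [dist_add_right]
    exact hsep _ _ (hx _) j j' fun heq => hne (by rw [heq])
  obtain ⟨ψ, Y, hψ, hYsep, hlim⟩ := exists_subseq_forall_eventually_ballMatch hδ Yk hsepY
  have hY : IsLocalLimitOfGroundStates lennardJones 3 Y := by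
    rw [isLocalLimitOfGroundStates_iff_ballMatch]
    exact ⟨x, φ ∘ ψ, fun k => -(x (φ (ψ k)) (i (ψ k))), hx, hφ.comp hψ, fun R ε hε => hlim R ε hε⟩
  -- the limit is `r₀`-dense
  have hdense : ∀ c : EuclideanSpace ℝ (Fin 3), ∃ q ∈ Y, dist q c ≤ r₀ := by
    intro c
    obtain ⟨q, hq, hqc⟩ := exists_le_of_forall_pos_exists_le_add
      (finite_inter_closedBall_of_sep hδ hYsep c (r₀ + 1)) (g := fun q => dist q c) (r := r₀)
      (fun η hη => by
        set ε' : ℝ := min η 1 with hε'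
        have hε'0 : 0 < ε' := lt_min hη one_pos
        obtain ⟨k, hk1, hk2⟩ :=
          ((eventually_ge_atTop ⌈‖c‖⌉₊).and (hlim (‖c‖ + r₀) ε' hε'0)).exists
        have hkc : ‖c‖ ≤ (ψ k : ℝ) + 1 := by
          have h1 : ‖c‖ ≤ ⌈‖c‖⌉₊ := Nat.le_ceil _
          have h2 : (⌈‖c‖⌉₊ : ℝ) ≤ k := by exact_mod_cast hk1
          have h3 : (k : ℝ) ≤ ψ k := by exact_mod_cast hψ.le_apply
          linarith
        obtain ⟨j, hj⟩ := hdeep (ψ k) (c + x (φ (ψ k)) (i (ψ k)))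
          (by rwa [dist_eq_norm, add_sub_cancel_right])
        have hy : x (φ (ψ k)) j + -(x (φ (ψ k)) (i (ψ k))) ∈ Yk (ψ k) := ⟨j, rfl⟩
        have hyc : dist (x (φ (ψ k)) j + -(x (φ (ψ k)) (i (ψ k)))) c < r₀ := by
          rw [dist_comm, dist_eq_norm] at hj
          rw [dist_eq_norm]
          convert hj using 2
          abel
        obtain ⟨q, hq, hyq⟩ := hk2.2 _ hy (by
          rw [dist_zero_right]
          have := dist_triangle (x (φ (ψ k)) j + -(x (φ (ψ k)) (i (ψ k)))) c 0
          rw [dist_zero_right, dist_zero_right] at this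
          linarith)
        have hε'1 : ε' ≤ 1 := min_le_right _ _
        have hε'η : ε' ≤ η := min_le_left _ _
        have hqc : dist q c ≤ r₀ + ε' := by
          have := dist_triangle_left q c (x (φ (ψ k)) j + -(x (φ (ψ k)) (i (ψ k))))
          linarith
        exact ⟨q, ⟨hq, mem_closedBall.2 (by linarith)⟩, by show dist q c ≤ r₀ + η; linarith⟩)
    exact ⟨q, hq.1, hqc⟩
  -- a good particle of the limit ...
  obtain ⟨p, hp, a, h, hab, A, q, hq, hW⟩ :=
    hcore Y hY hdense (R + 2) (ε / 4) (by linarith) (by positivity) (by linarith)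
  have hW' : BallMatch (ε / 4) ((R + 1) + 2 * (ε / 8)) p Y ((fun s => p + A (s - q)) '' hcpStacking a h) :=
    hW.mono le_rfl (by linarith)
  -- ... pulls back to a good particle of a recentred configuration, near its (bad) centre
  obtain ⟨k, hk1, hk2⟩ := ((eventually_ge_atTop ⌈‖p‖ + 1⌉₊).and
    (hlim (dist p 0 + (R + 1) + ε / 4 + 3 * (ε / 8)) (ε / 8) (by positivity))).exists
  obtain ⟨y', hy', hdist, hWy⟩ := exists_ballMatch_based_of_near hp hW' hk2 (by linarith)
    (by positivity) (by positivity) le_rfl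
  obtain ⟨j, rfl⟩ := hy'
  have hWj := ballMatch_based_image_affine
    (LinearIsometry.id (R := ℝ) (E := EuclideanSpace ℝ (Fin 3))) (x (φ (ψ k)) (i (ψ k))) hWy
  have e1 : (fun y => LinearIsometry.id (R := ℝ) (E := EuclideanSpace ℝ (Fin 3)) y +
      x (φ (ψ k)) (i (ψ k))) '' Yk (ψ k) = Set.range (x (φ (ψ k))) := by
    show (fun y => LinearIsometry.id (R := ℝ) (E := EuclideanSpace ℝ (Fin 3)) y +
      x (φ (ψ k)) (i (ψ k))) '' Set.range (fun j => x (φ (ψ k)) j + -(x (φ (ψ k)) (i (ψ k)))) = _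
    rw [← Set.range_comp]
    congr 1
    funext j'
    simp
  have e2 : LinearIsometry.id (R := ℝ) (E := EuclideanSpace ℝ (Fin 3))
      (x (φ (ψ k)) j + -(x (φ (ψ k)) (i (ψ k)))) + x (φ (ψ k)) (i (ψ k)) = x (φ (ψ k)) j := by
    simp
  rw [e1, e2] at hWj
  have hgood : Good (φ (ψ k)) j := by
    simp only [hGood]
    exact ⟨a, h, hab, _, q, hq, (ballMatch_range_based_iff (x (φ (ψ k))) j _ q (hcpStacking a h) ε R).1
      (hWj.mono (by linarith) (by linarith))⟩
  refine hbad' (ψ k) j ?_ hgood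
  -- the good particle is within `ψ k + 1` of the bad centre
  have h1 : dist (x (φ (ψ k)) j) (x (φ (ψ k)) (i (ψ k))) =
      ‖x (φ (ψ k)) j + -(x (φ (ψ k)) (i (ψ k)))‖ := by rw [dist_eq_norm, sub_eq_add_neg]
  have h2 : ‖x (φ (ψ k)) j + -(x (φ (ψ k)) (i (ψ k)))‖ ≤ ‖p‖ + ε / 8 := by
    have := dist_triangle (x (φ (ψ k)) j + -(x (φ (ψ k)) (i (ψ k)))) p 0
    simp only [dist_zero_right] at this
    linarith
  have h3 : ‖p‖ + 1 ≤ (ψ k : ℝ) + 1 := by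
    have h4 : ‖p‖ + 1 ≤ ⌈‖p‖ + 1⌉₊ := Nat.le_ceil _
    have h5 : (⌈‖p‖ + 1⌉₊ : ℝ) ≤ k := by exact_mod_cast hk1
    have h6 : (k : ℝ) ≤ ψ k := by exact_mod_cast hψ.le_apply
    linarith
  rw [h1]
  linarith

/-! ## Counting -/

/-- `Nat.card` of a subtype of `Fin N` as the cardinality of a filtered `univ`. [folklore] -/
theorem natCard_subtype_eq_card_filter {N : ℕ} (P : Fin N → Prop) [DecidablePred P] :
    Nat.card {i : Fin N // P i} = (Finset.univ.filter P).card := by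
  rw [Nat.card_eq_fintype_card, Fintype.card_subtype]

/-- **Packing**: at most `(2L/δ + 1)³` particles of a `δ`-separated configuration lie within `L`
of a given point. [folklore] -/
theorem card_filter_dist_le {N : ℕ} (y : Fin N → EuclideanSpace ℝ (Fin 3)) {δ L : ℝ} (hδ : 0 < δ)
    (hL : 0 ≤ L) (hsep : ∀ i j, i ≠ j → δ ≤ dist (y i) (y j)) (p : EuclideanSpace ℝ (Fin 3)) :
    ((Finset.univ.filter fun i => dist (y i) p ≤ L).card : ℝ) ≤ (2 * L / δ + 1) ^ 3 := by
  classical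
  have hinj : Function.Injective y := fun i j hij => by
    by_contra hne
    have := hsep i j hne
    rw [hij, dist_self] at this
    linarith
  set s := (Finset.univ.filter fun i => dist (y i) p ≤ L).image y with hs
  have hcard : ((Finset.univ.filter fun i => dist (y i) p ≤ L).card : ℝ) = s.card := by
    rw [hs, Finset.card_image_of_injective _ hinj]
  rw [hcard]
  have h := card_le_of_separated_of_dist_le s p hδ hL (fun c hc => ?_) (fun c hc d hd hcd => ?_)
  · rwa [finrank_euclideanSpace_fin] at h
  · simp only [hs, Finset.mem_image, Finset.mem_filter, Finset.mem_univ, true_and] at hc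
    obtain ⟨i, hi, rfl⟩ := hc
    exact hi
  · simp only [hs, Finset.mem_image, Finset.mem_filter, Finset.mem_univ, true_and] at hc hd
    obtain ⟨i, -, rfl⟩ := hc
    obtain ⟨j, -, rfl⟩ := hd
    exact hsep i j fun hij => hcd (by rw [hij])

/-- **Lemma B (finite `N`).** Under the infinite-volume core (`hcore`, Lemma A) and `NoFoam`
at void size `r₀` (`hfoam`), every sequence of Lennard-Jones ground states has, at every scale
`(R, ε)` with `0 < ε ≤ 1`, for all large `N`, at least `ρ N` particles (`ρ = ρ(R, ε) > 0`) that
are good for some `hcpStacking a h`, `(a, h) ∈ B′`. [folklore] -/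
theorem eventually_density_good {r₀ : ℝ}
    (hcore : ∀ X : Set (EuclideanSpace ℝ (Fin 3)), IsLocalLimitOfGroundStates lennardJones 3 X →
      (∀ c, ∃ q ∈ X, dist q c ≤ r₀) → ∀ R ε : ℝ, 0 ≤ R → 0 < ε → ε ≤ 1 →
      ∃ p ∈ X, ∃ a h : ℝ, (191 / 200 ≤ a ∧ a ≤ 197 / 200 ∧ 81 / 100 * a ≤ h ∧ h ≤ 329 / 400 * a) ∧
        ∃ (A : EuclideanSpace ℝ (Fin 3) →ₗᵢ[ℝ] EuclideanSpace ℝ (Fin 3)) (q : EuclideanSpace ℝ (Fin 3)),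
          q ∈ hcpStacking a h ∧ BallMatch ε R p X ((fun s => p + A (s - q)) '' hcpStacking a h))
    (hfoam : ∀ R : ℝ, 0 < R → ∀ x : (N : ℕ) → (Fin N → EuclideanSpace ℝ (Fin 3)),
      (∀ N, IsGroundState lennardJones (x N)) →
      Tendsto (fun N : ℕ => (Nat.card {i : Fin N // ∃ c : EuclideanSpace ℝ (Fin 3),
        dist c (x N i) ≤ R ∧ ∀ j : Fin N, r₀ ≤ dist c (x N j)} : ℝ) / N) atTop (𝓝 0))
    (x : (N : ℕ) → Fin N → EuclideanSpace ℝ (Fin 3))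
    (hx : ∀ N, IsGroundState lennardJones (x N)) {R ε : ℝ} (hR : 0 ≤ R) (hε : 0 < ε) (hε1 : ε ≤ 1) :
    ∃ ρ : ℝ, 0 < ρ ∧ ∀ᶠ N : ℕ in atTop, ρ * (N : ℝ) ≤ (Nat.card {i : Fin N // ∃ a h : ℝ,
      (191 / 200 ≤ a ∧ a ≤ 197 / 200 ∧ 81 / 100 * a ≤ h ∧ h ≤ 329 / 400 * a) ∧
      ∃ A : EuclideanSpace ℝ (Fin 3) →ₗᵢ[ℝ] EuclideanSpace ℝ (Fin 3), ∃ q ∈ hcpStacking a h,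
        (∀ s ∈ hcpStacking a h, dist s q ≤ R → ∃ j, dist (x N j) (x N i + A (s - q)) ≤ ε) ∧
        (∀ j, dist (x N j) (x N i) ≤ R →
          ∃ s ∈ hcpStacking a h, dist (x N j) (x N i + A (s - q)) ≤ ε)} : ℝ) := by
  classical
  set Good : (N : ℕ) → Fin N → Prop := fun N j => ∃ a h : ℝ,
      (191 / 200 ≤ a ∧ a ≤ 197 / 200 ∧ 81 / 100 * a ≤ h ∧ h ≤ 329 / 400 * a) ∧
      ∃ A : EuclideanSpace ℝ (Fin 3) →ₗᵢ[ℝ] EuclideanSpace ℝ (Fin 3), ∃ q ∈ hcpStacking a h,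
        (∀ s ∈ hcpStacking a h, dist s q ≤ R → ∃ j', dist (x N j') (x N j + A (s - q)) ≤ ε) ∧
        (∀ j', dist (x N j') (x N j) ≤ R → ∃ s ∈ hcpStacking a h, dist (x N j') (x N j + A (s - q)) ≤ ε)
    with hGood
  obtain ⟨L, R', hR', N₀, hnear⟩ := exists_good_near_deep hcore x hx hR hε hε1
  obtain ⟨δ, hδ, hsep⟩ := LennardJonesMinimalDistance_holds
  set C : ℝ := (2 * max L 0 / δ + 1) ^ 3 with hC
  have hCpos : 0 < C := by positivity
  refine ⟨1 / (2 * C), by positivity, ?_⟩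
  have hvoid := (hfoam R' hR' x hx).eventually (gt_mem_nhds (by norm_num : (0 : ℝ) < 1 / 2))
  filter_upwards [hvoid, eventually_ge_atTop N₀, eventually_gt_atTop 0] with N hN1 hN2 hN3
  -- the void particles `V`, the deep particles `D = univ \ V`, the good particles `G`
  set Void : Fin N → Prop := fun i => ∃ c : EuclideanSpace ℝ (Fin 3),
    dist c (x N i) ≤ R' ∧ ∀ j : Fin N, r₀ ≤ dist c (x N j) with hVoid
  have hN0 : (0 : ℝ) < N := by exact_mod_cast hN3
  have hV : ((Finset.univ.filter Void).card : ℝ) ≤ N / 2 := by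
    have h1 : (Nat.card {i : Fin N // Void i} : ℝ) / N < 1 / 2 := hN1
    rw [natCard_subtype_eq_card_filter, div_lt_iff₀ hN0] at h1
    linarith
  have hD : (N : ℝ) / 2 ≤ ((Finset.univ.filter fun i => ¬ Void i).card : ℝ) := by
    have h1 := Finset.card_filter_add_card_filter_not (s := Finset.univ) Void
    rw [Finset.card_univ, Fintype.card_fin] at h1
    have h2 : ((Finset.univ.filter Void).card : ℝ) + ((Finset.univ.filter fun i => ¬ Void i).card : ℝ)
        = N := by exact_mod_cast h1
    linarith
  -- each deep particle has a good particle within `L`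
  have hsub : (Finset.univ.filter fun i => ¬ Void i) ⊆ (Finset.univ.filter (Good N)).biUnion
      fun j => Finset.univ.filter fun i => dist (x N i) (x N j) ≤ max L 0 := by
    intro i hi
    simp only [Finset.mem_filter, Finset.mem_univ, true_and] at hi
    obtain ⟨j, hji, hgood⟩ := hnear N hN2 i hi
    simp only [Finset.mem_biUnion, Finset.mem_filter, Finset.mem_univ, true_and]
    exact ⟨j, hgood, by rw [dist_comm]; exact hji.trans (le_max_left _ _)⟩
  have hcount : ((Finset.univ.filter fun i => ¬ Void i).card : ℝ) ≤
      (Finset.univ.filter (Good N)).card * C := by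
    have h1 := (Finset.card_le_card hsub).trans Finset.card_biUnion_le
    have h2 : (((Finset.univ.filter (Good N)).sum fun j =>
        (Finset.univ.filter fun i => dist (x N i) (x N j) ≤ max L 0).card : ℕ) : ℝ) ≤
        (Finset.univ.filter (Good N)).sum fun _ => C := by
      push_cast
      refine Finset.sum_le_sum fun j _ => ?_
      exact card_filter_dist_le (x N) hδ (le_max_right _ _) (fun i j hij => hsep _ _ (hx N) i j hij) _
    rw [Finset.sum_const, nsmul_eq_mul] at h2
    exact le_trans (by exact_mod_cast h1) h2
  have hG : Nat.card {i : Fin N // Good N i} = (Finset.univ.filter (Good N)).card :=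
    natCard_subtype_eq_card_filter _
  show 1 / (2 * C) * (N : ℝ) ≤ (Nat.card {i : Fin N // Good N i} : ℝ)
  rw [hG]
  rw [div_mul_eq_mul_div, one_mul, div_le_iff₀ (by positivity)]
  nlinarith

end Summit.AtomisticToContinuum.Crystallization.Theorems.GscHingeGlue

end
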